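import Literature.NumberTheory.Automorphic.CDTTheorem722
import Literature.NumberTheory.Automorphic.CDTTheorem722Proofs
import Literature.NumberTheory.Automorphic.CDTTheorem722ThreeFactsProofs
import Literature.NumberTheory.EllipticCurves.InertiaInvariantsAdditiveProofs
import Literature.NumberTheory.Automorphic.CDTTheorem712
import Literature.NumberTheory.Automorphic.CDTTheorem712TwoLiftsProofs
import Literature.NumberTheory.Automorphic.BCDTTheoremB
import Literature.NumberTheory.EllipticCurves.NewformsLevelEqOfHeckeEigenvalueEqProofs
import Literature.NumberTheory.EllipticCurves.NewformsEqOfHeckeEigenvalueEqProofs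
import Literature.NumberTheory.EllipticCurves.NewformsHeckeProofs
import Literature.NumberTheory.EllipticCurves.NewformGaloisRepEulerFactors
import Literature.NumberTheory.EllipticCurves.Szpiro
import Literature.NumberTheory.EllipticCurves.CuspFormTwist
import Literature.NumberTheory.EllipticCurves.HeckeOperatorsProofs
import Summits.ABC.ABC.Theorems.DefiniteXiFreyModularityIsModular
import Literature.NumberTheory.EllipticCurves.TateModuleTwistNewformEulerFactorsProofs
import Literature.NumberTheory.EllipticCurves.CuspFormLFunctionLevelConductorOfCarayolProofs
import Literature.NumberTheory.EllipticCurves.EisensteinNewformLevelRaising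
import Literature.NumberTheory.EllipticCurves.HasseWeilAbelianEulerFactorForallProofs
import Literature.NumberTheory.EllipticCurves.ModularityVersionApProofs
import Literature.NumberTheory.EllipticCurves.RootNumberAtkinLehnerSemistableProofs
import Literature.NumberTheory.GaloisRepresentations.CoinvariantsCharpolyBaseChange
import Literature.NumberTheory.EllipticCurves.TateModuleIrreducibleFrobenius
import Literature.NumberTheory.EllipticCurves.CuspFormLFunctionLevelConductorProofs
import Literature.NumberTheory.GaloisRepresentations.FramedRepBaseChange
import Literature.NumberTheory.GaloisRepresentations.OddAbsolutelyIrreducibleProofs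
import Literature.AlgebraicGeometry.Motives.FaltingsECEndCoreCasesProofs
import Literature.RepresentationTheory.IrreducibleTwistTransport
import Literature.NumberTheory.GaloisRepresentations.FramedRepEquivConj
import Literature.NumberTheory.EllipticCurves.NeronOggShafarevichProofs
import HarnessLib
import Literature.NumberTheory.DiophantineGeometry.ConductorAdditiveProofs
import Summits.ABC.ABC.Theorems.DefiniteXiFreyModularityCMCorner
import Literature.NumberTheory.DiophantineGeometry.GeneralizedFermatTwoPowerCoefficientFreySwanEightProofs
import Literature.NumberTheory.DiophantineGeometry.GeneralizedFermatTwoPowerCoefficientFreySaitoProofs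
import Literature.NumberTheory.DiophantineGeometry.GeneralizedFermatTwoPowerCoefficientFreyIsogenyProofs
import Literature.NumberTheory.DiophantineGeometry.FreyCurveConductorTwoBadSignProofs
import Literature.NumberTheory.DiophantineGeometry.FreyCurveConductorTwoTwistDichotomyProofs
import Literature.NumberTheory.DiophantineGeometry.DenesEquationFreyCurveTwoProofs
import Literature.NumberTheory.DiophantineGeometry.DenesEquationLargeExponentsProofs
import Literature.NumberTheory.DiophantineGeometry.LocalReductionProofs
import Literature.NumberTheory.EllipticCurves.QuadraticTwistSwanConductorMaxProofs
import Literature.NumberTheory.EllipticCurves.QuadraticTwistTateFormTwoProofs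
import Literature.NumberTheory.EllipticCurves.CanonicalPAdicHeightRestrictionProofs
import Literature.NumberTheory.Automorphic.BCDTModularity

/-!
# Stub ideation k = 2, generation 7 (RESHAPE), for `stub_threeImpTwo` (S9) of crux `FreyModularity`
# (stmt-ABC-11340, route-ABC-DefiniteXi) — companion of `STUB-IDEAS-stub_threeImpTwo-2.md` (gen 7).

## The EXACT CUT of S9

Gens 1–6 (all three ideators) kernel-checked SUFFICIENT glue: S9 ⇐ {realisation leaf, level leaf,
Steinberg sign bit} under various named facts (Eichler–Shimura / Carayol (A) / Carayol Euler factor /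
Deligne–Rapoport …).  Gen 7 (this file) proves that this three-way regime split is not a choice but
FORCED: the verbatim stub is EQUIVALENT, over the current tree (no named fact assumed), to the
conjunction of three statements, each STRICTLY WEAKER than S9 and each living in exactly one
literature world —

* `SomeLevelPacket`      (R, realisation): a modular `ρ_{W,ℓ}` yields a rational `Γ₀(N)`-newform
  packet at SOME level `N` (`a_p(f₀) = a_p(W)` for `p ∤ N`, `W` good off `N`);
* `LevelRigidity`        (L, conductor = level): every such packet has `N = N_W`;
* `SteinbergSignPacket`  (S, the sign bit): at level `N = N_W`, `a_p(f₀) = a_p(W)` for `p ∥ N`;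

`stub_iff_cut : SigStubThreeImpTwo ↔ SomeLevelPacket ∧ LevelRigidity ∧ SteinbergSignPacket`.

The new ingredient making the CONVERSES provable is G7-1 `isModularGaloisRepTate_of_packet`: a packet
`(W, N, f₀)` makes `ρ_{W,ℓ}` modular for EVERY prime `ℓ` (BCDT (2) ⇒ (4) run on the packet instead of
on `IsNewformOf`, with `K = ℚ̄_ℓ` and `ι : K_f ⊂ ℂ ≃ ℚ̄_ℓ`, so that no rationality of the `aₙ`, `n`
composite or `p ∣ N`, is needed).  Hence any proof of S9 restricted to packets PROVES `N = N_W` and the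
Steinberg signs for every rational weight-`2` packet with an attached curve — Carayol's level statement
and the Deligne–Rapoport sign, in that generality, are not only sufficient (gens 4–6) but NECESSARY:
the named-fact debt of S9 measured by gens 1–6 is a lower bound, not an artefact of the chosen glue.

All declarations below are `sorry`-free.  Transcribed (verbatim, because crux-dir companions are not
importable on the farm): `SigStubThreeImpTwo`, `SomeLevelPacket`, `SteinbergSignPacket`, M1
`level_eq_and_cuspCoeff_eq_of_cuspCoeff_eq_off`, L1 `isNewformOf_of_packet_of_level_eq_of_sign`,
`map_heckePolynomial_liftToGamma1_of_cuspCoeff_eq`, `ne_zero_of_isNewform0` (k2 gen 6 companion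
`STUB_IDEAS_stub_threeImpTwo_2g6_Sketch.lean`, rc 0 / 0 sorries re-checked 2026-08-31).
-/

open scoped NumberField Polynomial MatrixGroups ModularForm
open NumberField IsDedekindDomain IsDedekindDomain.HeightOneSpectrum Field Polynomial
open CongruenceSubgroup Rat.HeightOneSpectrum
open Literature.NumberTheory.EllipticCurves
open Literature.NumberTheory.EllipticCurves.ModularForms
open Literature.NumberTheory.Automorphic
open Literature.NumberTheory.Automorphic.BCDT
open Literature.NumberTheory.GaloisRepresentations
open WeierstrassCurve

namespace Summit.ABC.ABC.Cruxes.FreyModularity.Sketch.StubIdeasThreeImpTwo2G7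

/-! ## §0 The stub (verbatim) and the three pieces of the cut -/

/-- The registered stub S9 (`Lines/Sketch.lean :186`), verbatim. -/
def SigStubThreeImpTwo : Prop :=
  ∀ (W : WeierstrassCurve ℚ) [W.IsElliptic] [NeZero (W.conductorNorm ℤ)] (ℓ : ℕ) [Fact ℓ.Prime],
    W.IsModularGaloisRepTate ℓ → BCDT.IsModular W

/-- **R — `SomeLevelPacket` (k2 gen 6, verbatim): the realisation leaf in packet shape.**  A modular
`ρ_{W,ℓ}` yields a rational weight-`2` `Γ₀(N)`-newform packet at SOME level `N`: `a_p(f₀) = a_p(W)`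
for every prime `p ∤ N` (hole at `ℓ` filled) and `W` good off `N`.  In print: Eichler–Shimura /
Deligne's `ρ_{f,λ'}` at a second prime + Faltings, or BCDT (3) at two primes (k2 gen 4, PROVED under
the compatible-system recut). [cite: BCDTJAMS2001, Introduction ((3) ⇒ (2))]
[cite: DiamondShurman2005, Thm. 8.8.1, Thm. 9.5.4] -/
def SomeLevelPacket : Prop :=
  ∀ (W : WeierstrassCurve ℚ) [W.IsElliptic] (ℓ : ℕ) [Fact ℓ.Prime], W.IsModularGaloisRepTate ℓ →
    ∃ (N : ℕ) (_ : NeZero N) (f₀ : CuspForm (Gamma0 N) 2), IsNewform0 f₀ ∧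
      (∀ v : HeightOneSpectrum (𝓞 ℚ), ¬ ((primesEquiv v : ℕ) ∣ N) → W.HasGoodReductionAt v) ∧
      ∀ p : ℕ, p.Prime → ¬ p ∣ N → cuspCoeff f₀ p = (W.LFunction p : ℂ)

/-- **L — `LevelRigidity` (NEW as a stand-alone piece): the level of a packet is the conductor.**
For every elliptic `W/ℚ` and every newform `f₀ ∈ S₂(Γ₀(N))` with `W` good off `N` and
`a_p(f₀) = a_p(W)` for all primes `p ∤ N`: `N = N_W`.  In print this is Carayol's theorem (A)
(`N(ρ_f) = N`) combined with `N(ρ_{W,ℓ}) = N_W` (Ogg–Saito); k2 gen 6 H2 / k3 gen 6 L0 PROVE it from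
the named fact `Carayol1986_artinConductorExponent` + Saito's `p = 2` leaf; for square-free `N_W` the
tree's `IsNewformOf.level_eq_conductorNorm_of_squarefree` needs `Carayol1986_eulerFactor` instead.
Gen 7 shows it is also a CONSEQUENCE of S9 (`levelRigidity_of_stub`).
[cite: CarayolASENS1986, Thm. (A), (0.8) Corollaire] [cite: DarmonDiamondTaylor1995, Thm. 3.1 (d)]
[cite: Saito1988, Theorem 1] -/
def LevelRigidity : Prop :=
  ∀ (W : WeierstrassCurve ℚ) [W.IsElliptic] {N : ℕ} [NeZero N] (f₀ : CuspForm (Gamma0 N) 2),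
    IsNewform0 f₀ →
    (∀ v : HeightOneSpectrum (𝓞 ℚ), ¬ ((primesEquiv v : ℕ) ∣ N) → W.HasGoodReductionAt v) →
    (∀ p : ℕ, p.Prime → ¬ p ∣ N → cuspCoeff f₀ p = (W.LFunction p : ℂ)) →
    N = W.conductorNorm ℤ

/-- **S — `SteinbergSignPacket` (k3 gen 5 / k2 gen 6, verbatim): the sign bit at the multiplicative
places.**  At level `N = N_W`, `a_p(f₀) = a_p(W) ∈ {±1}` for every `p ∥ N`.  In print Darmon–Diamond–
Taylor Thm. 3.1 (e), first case (Deligne–Rapoport); k2 gen 6 H5 PROVES it from the typed residual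
`Newform0SteinbergCoinvariants`.  Gen 7: also a consequence of S9 (`steinbergSignPacket_of_stub`).
[cite: DarmonDiamondTaylor1995, Thm. 3.1 (e) (p. 86) and p. 87] [cite: CarayolASENS1986, Thm. (A)] -/
def SteinbergSignPacket : Prop :=
  ∀ (W : WeierstrassCurve ℚ) [W.IsElliptic] {N : ℕ} [NeZero N] (f₀ : CuspForm (Gamma0 N) 2),
    IsNewform0 f₀ → N = W.conductorNorm ℤ →
    (∀ v : HeightOneSpectrum (𝓞 ℚ), ¬ ((primesEquiv v : ℕ) ∣ N) → W.HasGoodReductionAt v) →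
    (∀ p : ℕ, p.Prime → ¬ p ∣ N → cuspCoeff f₀ p = (W.LFunction p : ℂ)) →
    ∀ p : ℕ, p.Prime → p ∣ N → ¬ p ^ 2 ∣ N → cuspCoeff f₀ p = (W.LFunction p : ℂ)

/-- **L ∧ S in one line — `FullRigidity`: every packet IS the newform of `W` at level `N_W`**
(`N = N_W` and `aₙ(f₀) = aₙ(W)` for all `n`).  `fullRigidity_iff : FullRigidity ↔ L ∧ S`.
[cite: DiamondShurman2005, Thm. 8.8.1 / Def. 8.8.2] -/
def FullRigidity : Prop :=
  ∀ (W : WeierstrassCurve ℚ) [W.IsElliptic] {N : ℕ} [NeZero N] (f₀ : CuspForm (Gamma0 N) 2),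
    IsNewform0 f₀ →
    (∀ v : HeightOneSpectrum (𝓞 ℚ), ¬ ((primesEquiv v : ℕ) ∣ N) → W.HasGoodReductionAt v) →
    (∀ p : ℕ, p.Prime → ¬ p ∣ N → cuspCoeff f₀ p = (W.LFunction p : ℂ)) →
    N = W.conductorNorm ℤ ∧ ∀ n : ℕ, cuspCoeff f₀ n = (W.LFunction n : ℂ)

/-! ## §1 Transcribed lemmas (k2 gen 6 companion, verbatim; all proved) -/

section Transcribed

variable (W : WeierstrassCurve ℚ) [W.IsElliptic] {N : ℕ} [NeZero N] (f₀ : CuspForm (Gamma0 N) 2)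

omit [W.IsElliptic] in
/-- A `Γ₀(N)`-newform is not the zero form (`a₁ = 1`). [folklore] -/
theorem ne_zero_of_isNewform0 (hf₀ : IsNewform0 f₀) : f₀ ≠ 0 := by
  intro h0
  have h1 : cuspCoeff f₀ 1 = 1 := hf₀.2.2
  rw [h0, cuspCoeff, CuspForm.coe_zero, UpperHalfPlane.qExpansion_zero, map_zero] at h1
  exact zero_ne_one h1

omit [W.IsElliptic] in
/-- **The Hecke polynomial of the `Γ₁(N)`-lift of `f₀` at a prime `q ∤ N` carrying `a_q(W)`**, read in
`ℚ̄_ℓ`: `X² - a_q(W) X + q`. [folklore] -/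
theorem map_heckePolynomial_liftToGamma1_of_cuspCoeff_eq (hne : f₀ ≠ 0) (ℓ : ℕ) [Fact ℓ.Prime]
    (ι : PadicAlgCl ℓ ≃+* ℂ) {q : ℕ} (hq : q.Prime) (hqN : ¬ q ∣ N)
    (ha : cuspCoeff f₀ q = (W.LFunction q : ℂ)) :
    (heckePolynomial (liftToGamma1 N 2 f₀) q).map
        ((ι.symm : ℂ →+* PadicAlgCl ℓ).comp (algebraMap (coeffCharField (liftToGamma1 N 2 f₀)) ℂ)) =
      X ^ 2 - C ((W.LFunction q : ℤ) : PadicAlgCl ℓ) * X + C ((q : ℕ) : PadicAlgCl ℓ) := by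
  rw [← Polynomial.map_map, map_heckePolynomial, coe_liftToGamma1_holds N 2 f₀]
  have ha' : (UpperHalfPlane.qExpansion 1 ⇑f₀).coeff q = (W.LFunction q : ℂ) := ha
  have hε : nebentypus (liftToGamma1 N 2 f₀) (q : ZMod N) = 1 := by
    rw [nebentypus_liftToGamma1_holds N 2 hne,
      MulChar.one_apply ((ZMod.isUnit_prime_iff_not_dvd hq).mpr hqN)]
  rw [ha', hε]
  have h21 : ((2 : ℤ) - 1) = 1 := by norm_num
  simp [Polynomial.map_sub, Polynomial.map_add, Polynomial.map_mul, h21]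

omit [W.IsElliptic] [NeZero N] in
/-- **M1 — strong multiplicity one across levels, coefficient form** (Diamond–Shurman Thm. 5.8.2 with
Atkin–Lehner–Li; the tree's `IsNewform0.level_eq_of_heckeEigenvalue_eq_holds`,
`IsNewform0.eq_of_heckeEigenvalue_eq_holds`): two `Γ₀` newforms of weight `2` whose prime coefficients
agree off a finite modulus have the same level and the same `q`-expansion.
[cite: DiamondShurman2005, Thm. 5.8.2] [cite: AtkinLehner1970, Thm. 4] -/
theorem level_eq_and_cuspCoeff_eq_of_cuspCoeff_eq_off {N₁ N₂ : ℕ} [NeZero N₁] [NeZero N₂]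
    {f₁ : CuspForm (Gamma0 N₁) 2} {f₂ : CuspForm (Gamma0 N₂) 2} (hf₁ : IsNewform0 f₁)
    (hf₂ : IsNewform0 f₂) {M : ℕ} (hM : M ≠ 0)
    (h : ∀ p : ℕ, p.Prime → ¬ p ∣ M → cuspCoeff f₁ p = cuspCoeff f₂ p) :
    ∃ e : N₁ = N₂, ∀ n : ℕ, cuspCoeff f₁ n = cuspCoeff (e ▸ f₂) n := by
  have hfin : {p : ℕ | p.Prime ∧ heckeEigenvalue f₁ p ≠ heckeEigenvalue f₂ p}.Finite := by
    refine M.primeFactors.finite_toSet.subset ?_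
    rintro p ⟨hp, hne⟩
    refine (Nat.mem_primeFactors_of_ne_zero hM).mpr ⟨hp, ?_⟩
    by_contra hpM
    apply hne
    rw [heckeEigenvalue_eq_coeff_of_isNormalized hf₁.2.2 hp (hf₁.2.1 p hp),
      heckeEigenvalue_eq_coeff_of_isNormalized hf₂.2.2 hp (hf₂.2.1 p hp)]
    exact h p hp hpM
  have hN : N₁ = N₂ := IsNewform0.level_eq_of_heckeEigenvalue_eq_holds hf₁ hf₂ hfin
  subst hN
  refine ⟨rfl, fun n ↦ ?_⟩
  rw [IsNewform0.eq_of_heckeEigenvalue_eq_holds hf₁ hf₂ hfin]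

/-- **L1 — packet + `N = N_W` + the sign at `p ∥ N` ⇒ `IsNewformOf`** (elementary: at `p² ∣ N` both
sides vanish, Atkin–Lehner Thm. 3 / additive reduction; prime values + Hecke recursions determine all
`aₙ`, Diamond–Shurman (8.43)–(8.44)). [cite: AtkinLehner1970, Thm. 3]
[cite: DiamondShurman2005, §8.8 (8.43)–(8.44), Thm. 8.8.3] [cite: SilvermanATAEC1994, Thm. IV.10.2] -/
theorem isNewformOf_of_packet_of_level_eq_of_sign (hf₀ : IsNewform0 f₀) (hN : N = W.conductorNorm ℤ)
    (hap : ∀ p : ℕ, p.Prime → ¬ p ∣ N → cuspCoeff f₀ p = (W.LFunction p : ℂ))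
    (hsign : ∀ p : ℕ, p.Prime → p ∣ N → ¬ p ^ 2 ∣ N → cuspCoeff f₀ p = (W.LFunction p : ℂ)) :
    IsNewformOf W f₀ := by
  subst hN
  refine isNewformOf_of_forall_prime_cuspCoeff_eq (fun u ↦ conductorExponent_eq_zero_iff_holds u W)
    hf₀ fun p hp ↦ ?_
  by_cases hpN : p ∣ W.conductorNorm ℤ
  · by_cases hp2 : p ^ 2 ∣ W.conductorNorm ℤ
    · -- additive prime: `a_p(f₀) = 0 = a_p(W)`
      rw [hf₀.cuspCoeff_eq_zero_of_sq_dvd hp hp2]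
      haveI : Fact p.Prime := ⟨hp⟩
      set w : HeightOneSpectrum (𝓞 ℚ) := (primesEquiv (R := 𝓞 ℚ)).symm ⟨p, hp⟩ with hw
      have hpw : (primesEquiv w : Nat.Primes) = ⟨p, hp⟩ := Equiv.apply_symm_apply _ _
      have hgen : natGenerator ((primesEquiv (R := ℤ)).symm (primesEquiv w)) = p := by
        rw [hpw]
        exact congrArg (fun x : Nat.Primes ↦ (x : ℕ))
          (Equiv.apply_symm_apply (primesEquiv (R := ℤ)) ⟨p, hp⟩)
      have h2f : 2 ≤ W.conductorExponent w := by
        have h1 : 2 ≤ (W.conductorNorm ℤ).factorization p :=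
          (hp.pow_dvd_iff_le_factorization (NeZero.ne _)).mp hp2
        rw [W.conductorExponent_ringOfIntegers_eq w,
          ← W.factorization_conductorNorm_holds ((primesEquiv (R := ℤ)).symm (primesEquiv w)), hgen]
        exact h1
      have hadd : W.HasAdditiveReductionAt w := (two_le_conductorExponent_iff_holds w W).mp h2f
      have hv : ((primesEquiv w : Nat.Primes) : ℕ) = p := by rw [hpw]
      rw [W.LFunction_apply_eq_zero_of_hasAdditiveReductionAt hv hadd (dvd_refl p), Int.cast_zero]
    · exact hsign p hp hpN hp2
  · exact hap p hp hpN

end Transcribed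

/-! ## §2 G7-1 (NEW, proved): a packet makes `ρ_{W,ℓ}` modular at EVERY prime `ℓ` -/

/-- **G7-1 — the packet is Tate-modular everywhere** (BCDT, Introduction, (2) ⇒ (4), run on a
packet: the proof of the tree's `BCDT.IsModular.isModularGaloisRepTate` uses `IsNewformOf W f` only
through `a_p(f) = a_p(W)` and good reduction at the primes `p ∤ N ℓ`).  For an elliptic `W/ℚ`, a
newform `f₀ ∈ S₂(Γ₀(N))` with `W` good off `N` and `a_p(f₀) = a_p(W)` for `p ∤ N`, and ANY prime `ℓ`:
`W.IsModularGaloisRepTate ℓ`, witnessed by `f = liftToGamma1 N 2 f₀`, `K = ℚ̄_ℓ`,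
`ι = (ℚ̄_ℓ ≃ ℂ)⁻¹ ∘ (K_f ⊂ ℂ)` (so no rationality of `aₙ(f₀)` at `n` composite or `p ∣ N` is used):
inertia at `p ∤ N ℓ` acts trivially on `T_ℓ W` (Silverman VII.4.1 (a)), and
`charpoly(Frob_p | T_ℓ W) = X² - a_p(W) X + p = ι(X² - a_p(f) X + ε(p) p)` (Silverman C.21.3,
`ε = 𝟙`).  This is what makes the converses of §3 provable.
[cite: BCDTJAMS2001, Introduction ((1) ⇒ (4))] [cite: DiamondShurman2005, Thm. 9.4.1]
[cite: SilvermanAEC2009, Prop. VII.4.1 (a), C.21 Remark 21.3] -/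
theorem isModularGaloisRepTate_of_packet (W : WeierstrassCurve ℚ) [W.IsElliptic] {N : ℕ} [NeZero N]
    (f₀ : CuspForm (Gamma0 N) 2) (hf₀ : IsNewform0 f₀)
    (hgood : ∀ v : HeightOneSpectrum (𝓞 ℚ), ¬ ((primesEquiv v : ℕ) ∣ N) → W.HasGoodReductionAt v)
    (hap : ∀ p : ℕ, p.Prime → ¬ p ∣ N → cuspCoeff f₀ p = (W.LFunction p : ℂ))
    (ℓ : ℕ) [Fact ℓ.Prime] : W.IsModularGaloisRepTate ℓ := by
  classical
  have hℓp : ℓ.Prime := Fact.out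
  have hne : f₀ ≠ 0 := ne_zero_of_isNewform0 f₀ hf₀
  obtain ⟨ι⟩ := PadicAlgCl.nonempty_ringEquiv_complex ℓ
  have hnew : IsNewform1 (liftToGamma1 N 2 f₀) := (isNewform1_liftToGamma1_iff_holds N 2 f₀).mpr hf₀
  refine ⟨N, inferInstance, 2, liftToGamma1 N 2 f₀, PadicAlgCl ℓ, inferInstance, inferInstance,
    (ι.symm : ℂ →+* PadicAlgCl ℓ).comp (algebraMap (coeffCharField (liftToGamma1 N 2 f₀)) ℂ),
    by norm_num, hnew, ?_⟩
  intro v hv 𝔓 h𝔓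
  have hpp : (primesEquiv v : ℕ).Prime := (primesEquiv v).2
  have hpN : ¬ (primesEquiv v : ℕ) ∣ N := fun h ↦ hv (dvd_mul_of_dvd_left h _)
  have hpℓ : (primesEquiv v : ℕ) ≠ ℓ := fun h ↦ hv (by rw [← h]; exact dvd_mul_left _ _)
  have hgoodv : W.HasGoodReductionAt v := hgood v hpN
  have hℓv : ((ℓ : ℕ) : 𝓞 ℚ) ∉ v.asIdeal := by
    rw [Literature.NumberTheory.GaloisRepresentations.Rat.natCast_mem_asIdeal_iff]
    exact fun h ↦ hpℓ ((Nat.prime_dvd_prime_iff_eq hpp hℓp).mp h)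
  refine ⟨?_, ?_⟩
  · -- inertia at `p` acts trivially on `T_ℓ W = lim W[ℓⁿ]` (Silverman VII.4.1 (a), levelwise)
    intro τ hτ
    refine LinearMap.ext fun a ↦ ?_
    rw [Module.End.one_apply, galoisRepTate_apply_apply]
    refine TateModule.ext fun n ↦ ?_
    rw [TateModule.proj_smul_of_distribMulAction]
    have hℓnv : ((ℓ ^ n : ℕ) : 𝓞 ℚ) ∉ v.asIdeal := fun h ↦
      hℓv (v.isPrime.mem_of_pow_mem n (by rwa [← Nat.cast_pow]))
    exact W.smul_eq_of_mem_inertia_of_nsmul_eq_zero hgoodv hℓnv h𝔓 hτ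
      (TateModule.pow_smul_proj n a)
  · -- Frobenius: `X² - a_p(W) X + p` on both sides
    intro σ hσ
    have htr := W.trace_galoisRepTate_frobenius_of_hasGoodReductionAt_holds ℓ v hℓv hgoodv h𝔓 hσ
    have hdet := W.det_galoisRepTate_frobenius_of_hasGoodReductionAt_holds ℓ v hℓv hgoodv h𝔓 hσ
    rw [WeierstrassCurve.natCard_residueField_adicCompletionIntegers] at hdet
    rw [htr, hdet, map_heckePolynomial_liftToGamma1_of_cuspCoeff_eq W f₀ hne ℓ ι hpp hpN
      (hap _ hpp hpN), W.lFunction_primesEquiv_eq_frobeniusTraceAt hgoodv]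
    simp

/-! ## §3 The CONVERSES (NEW, proved): S9 ⇒ R, S9 ⇒ FullRigidity (⇒ L, ⇒ S) -/

/-- **S9 ⇒ R.**  If S9 holds, a modular `ρ_{W,ℓ}` gives `IsModular W`, i.e. the packet at level `N_W`
itself (`W` good off `N_W` by `dvd_conductorNorm_iff`, Diamond–Shurman §8.3).
[cite: DiamondShurman2005, §8.3] -/
theorem someLevelPacket_of_stub (h : SigStubThreeImpTwo) : SomeLevelPacket := by
  intro W _ ℓ _ hmod
  haveI : NeZero (W.conductorNorm ℤ) := ⟨(conductorNorm_pos_holds W).ne'⟩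
  obtain ⟨f, hf⟩ := h W ℓ hmod
  refine ⟨W.conductorNorm ℤ, inferInstance, f, hf.1, fun v hv ↦ ?_, fun p _ _ ↦ hf.2 p⟩
  by_contra hbad
  exact hv ((W.dvd_conductorNorm_iff v).mpr hbad)

/-- **S9 ⇒ FullRigidity.**  Given a packet `(W, N, f₀)`: by G7-1 `ρ_{W,2}` is modular, so S9 gives the
newform `f` of `W` at level `N_W` with `aₙ(f) = aₙ(W)`; `f₀` and `f` agree at the primes off
`N · N_W`, hence (M1, strong multiplicity one across levels) `N = N_W` and `f₀ = f`.
[cite: DiamondShurman2005, Thm. 5.8.2, Thm. 8.8.1] -/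
theorem fullRigidity_of_stub (h : SigStubThreeImpTwo) : FullRigidity := by
  intro W _ N _ f₀ hf₀ hgood hap
  haveI : NeZero (W.conductorNorm ℤ) := ⟨(conductorNorm_pos_holds W).ne'⟩
  obtain ⟨f, hf⟩ := h W 2 (isModularGaloisRepTate_of_packet W f₀ hf₀ hgood hap 2)
  have hM : N * W.conductorNorm ℤ ≠ 0 := mul_ne_zero (NeZero.ne N) (NeZero.ne _)
  have hagree : ∀ p : ℕ, p.Prime → ¬ p ∣ N * W.conductorNorm ℤ →
      cuspCoeff f₀ p = cuspCoeff f p := by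
    intro p hp hpM
    rw [hap p hp fun h' ↦ hpM (dvd_mul_of_dvd_left h' _), hf.2 p]
  obtain ⟨e, hcoeff⟩ := level_eq_and_cuspCoeff_eq_of_cuspCoeff_eq_off hf₀ hf.1 hM hagree
  subst e
  exact ⟨rfl, fun n ↦ by rw [hcoeff n]; exact hf.2 n⟩

/-- **S9 ⇒ L** (the level statement for rational weight-`2` packets is NECESSARY for S9). -/
theorem levelRigidity_of_stub (h : SigStubThreeImpTwo) : LevelRigidity :=
  fun W _ _ _ f₀ hf₀ hgood hap ↦ (fullRigidity_of_stub h W f₀ hf₀ hgood hap).1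

/-- **S9 ⇒ S** (the Steinberg sign bit is NECESSARY for S9). -/
theorem steinbergSignPacket_of_stub (h : SigStubThreeImpTwo) : SteinbergSignPacket :=
  fun W _ _ _ f₀ hf₀ _ hgood hap p _ _ _ ↦ (fullRigidity_of_stub h W f₀ hf₀ hgood hap).2 p

/-! ## §4 Sufficiency and the EXACT CUT -/

/-- `FullRigidity ↔ LevelRigidity ∧ SteinbergSignPacket` (⇐ is the elementary assembly L1). -/
theorem fullRigidity_iff : FullRigidity ↔ LevelRigidity ∧ SteinbergSignPacket := by
  refine ⟨fun hF ↦ ⟨fun W _ _ _ f₀ hf₀ hgood hap ↦ (hF W f₀ hf₀ hgood hap).1,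
    fun W _ _ _ f₀ hf₀ _ hgood hap p _ _ _ ↦ (hF W f₀ hf₀ hgood hap).2 p⟩, ?_⟩
  rintro ⟨hL, hS⟩ W _ N _ f₀ hf₀ hgood hap
  have hN : N = W.conductorNorm ℤ := hL W f₀ hf₀ hgood hap
  exact ⟨hN, (isNewformOf_of_packet_of_level_eq_of_sign W f₀ hf₀ hN hap
    (hS W f₀ hf₀ hN hgood hap)).2⟩

/-- **R ∧ FullRigidity ⇒ S9** (the sufficiency direction; two lines). -/
theorem stub_of_someLevelPacket_of_fullRigidity (hR : SomeLevelPacket) (hF : FullRigidity) :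
    SigStubThreeImpTwo := by
  intro W _ _ ℓ _ hmod
  obtain ⟨N, hN, f₀, hf₀, hgood, hap⟩ := hR W ℓ hmod
  obtain ⟨e, hall⟩ := hF W f₀ hf₀ hgood hap
  subst e
  exact ⟨f₀, hf₀, hall⟩

/-- **THE EXACT CUT (gen 7).**  Over the current tree, with no named fact assumed,
`stub_threeImpTwo ⟺ R ∧ L ∧ S`: the realisation leaf, the level = conductor statement for rational
weight-`2` packets, and the Steinberg sign bit are each necessary and jointly sufficient.
[cite: BCDTJAMS2001, Introduction ((3) ⇒ (2))] [cite: CarayolASENS1986, Thm. (A)]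
[cite: DarmonDiamondTaylor1995, Thm. 3.1 (d), (e)] -/
theorem stub_iff_cut : SigStubThreeImpTwo ↔ SomeLevelPacket ∧ LevelRigidity ∧ SteinbergSignPacket :=
  ⟨fun h ↦ ⟨someLevelPacket_of_stub h, fullRigidity_iff.mp (fullRigidity_of_stub h)⟩,
    fun h ↦ stub_of_someLevelPacket_of_fullRigidity h.1 (fullRigidity_iff.mpr h.2)⟩

/-- The cut in the exact registered shape of `stub_threeImpTwo` (for the lead / critic: the three
pieces R, L, S — each strictly weaker than S9 — compose to the verbatim stub). -/
theorem stub_threeImpTwo_of_cut (hR : SomeLevelPacket) (hL : LevelRigidity)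
    (hS : SteinbergSignPacket) :
    ∀ (W : WeierstrassCurve ℚ) [W.IsElliptic] [NeZero (W.conductorNorm ℤ)] (ℓ : ℕ) [Fact ℓ.Prime],
      W.IsModularGaloisRepTate ℓ → BCDT.IsModular W :=
  stub_iff_cut.mpr ⟨hR, hL, hS⟩

/-! ## §5 A by-product of G7-1: (3) at one prime ⇒ (4) at all primes, granted R alone -/

/-- **Hole-free propagation.**  Granted only the realisation leaf R, a modular `ρ_{W,ℓ₀}` at ONE prime
makes `ρ_{W,ℓ}` modular at EVERY prime (BCDT (3) ⇒ (4) without passing through (2)): R gives a packet,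
G7-1 re-attaches it at any `ℓ`.  So under R the single-prime stub S9 and k2's compatible-system recut
`SigThreeImpTwoCS` (gens 3–6) are the SAME statement — the `a_ℓ`-hole objection to S9 is exactly R.
[cite: BCDTJAMS2001, Introduction ((3) ⇔ (4))] -/
theorem isModularGaloisRepTate_all_of_someLevelPacket (hR : SomeLevelPacket) (W : WeierstrassCurve ℚ)
    [W.IsElliptic] (ℓ₀ : ℕ) [Fact ℓ₀.Prime] (h : W.IsModularGaloisRepTate ℓ₀) (ℓ : ℕ) [Fact ℓ.Prime] :
    W.IsModularGaloisRepTate ℓ := by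
  obtain ⟨N, hN, f₀, hf₀, hgood, hap⟩ := hR W ℓ₀ h
  exact isModularGaloisRepTate_of_packet W f₀ hf₀ hgood hap ℓ

/-! ## §6 The compatible-system recut is EXACTLY `L ∧ S` (NEW, proved)

k2 gens 3–6 recut S9 to the compatible-system form `SigThreeImpTwoCS` (hypothesis: `ρ_{W,p}` modular
for EVERY `p`, BCDT (4)) because from TWO primes the packet R is PROVED (M0 + M1 merge below).  With
G7-1 this becomes an exact statement: `SigThreeImpTwoCS ⟺ FullRigidity ⟺ L ∧ S`, and
`S9 ⟺ R ∧ SigThreeImpTwoCS` — the single-prime stub differs from its CS recut by exactly R. -/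

/-- BCDT condition (4): `ρ_{W,p}` is modular for EVERY prime `p` (k2 gen 6, verbatim). -/
def IsModularGaloisRepTateAll (W : WeierstrassCurve ℚ) : Prop :=
  ∀ (p : ℕ) [Fact p.Prime], W.IsModularGaloisRepTate p

/-- `h32CS` — S9 with the compatible-system hypothesis (k2 gen 6, verbatim). -/
def SigThreeImpTwoCS : Prop :=
  ∀ (W : WeierstrassCurve ℚ) [W.IsElliptic] [NeZero (W.conductorNorm ℤ)],
    IsModularGaloisRepTateAll W → BCDT.IsModular W

section TranscribedCS

/-- The `X`-coefficient of `X² - a X + b` is `-a` (ideator-1's helper, verbatim). [folklore] -/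
theorem coeff_one_X_sq_sub_C_mul_X_add_C' {S : Type*} [CommRing S] (a b : S) :
    (Polynomial.X ^ 2 - Polynomial.C a * Polynomial.X + Polynomial.C b).coeff 1 = -a := by
  simp [Polynomial.coeff_X_pow, Polynomial.coeff_C]

/-- **M0 (descent KEEPING the inertia clause; ideator-1's H1, ported verbatim — PROVED).**
`ρ_{E,ℓ}` modular ⇒ a newform `f₀ ∈ S₂(Γ₀(N))` with `E` good off `N ℓ` (Néron–Ogg–Shafarevich on the
inertia clause of `IsModularGaloisRepTate`) and `a_p(f₀) = a_p(E)` for `p ∤ N ℓ` (the `X`-coefficient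
of the Frobenius polynomial); the tree's `exists_rational_isNewform0_of_isModularGaloisRepTate'`
forgets the good reduction, which the merge below needs. -/
theorem exists_isNewform0_hasGoodReductionAt_of_isModularGaloisRepTate
    (W : WeierstrassCurve ℚ) [W.IsElliptic] (ℓ : ℕ) [Fact ℓ.Prime] (h : W.IsModularGaloisRepTate ℓ) :
    ∃ (N : ℕ) (_ : NeZero N) (f₀ : CuspForm (Gamma0 N) 2), IsNewform0 f₀ ∧
      (∀ v : HeightOneSpectrum (𝓞 ℚ), ¬ ((primesEquiv v : ℕ) ∣ N * ℓ) → W.HasGoodReductionAt v) ∧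
      ∀ p : ℕ, p.Prime → ¬ p ∣ N * ℓ → cuspCoeff f₀ p = (W.LFunction p : ℂ) := by
  classical
  have hℓp : ℓ.Prime := Fact.out
  obtain ⟨N, hN, f, K, hK, hA, ι, hnew, hε, hcl⟩ := (isModularGaloisRepTate_iff_weight_two W ℓ).mp h
  -- descent to `Γ₀(N)`
  have hdia : ∀ d : ZMod N, IsUnit d → diamondOp N 2 d f = f := by
    intro d hd
    obtain ⟨u, rfl⟩ := hd
    rw [hnew.diamondOp_apply_eq_nebentypus_smul u, hε, MulChar.one_apply_coe, one_smul]
  obtain ⟨f₀, hf₀⟩ := exists_liftToGamma1_eq_of_forall_diamondOp_eq 2 f hdia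
  have hnew₀ : IsNewform0 f₀ := (isNewform1_liftToGamma1_iff_holds N 2 f₀).mp (hf₀ ▸ hnew)
  have hcoe : (⇑f₀ : UpperHalfPlane → ℂ) = ⇑f := by rw [← hf₀, coe_liftToGamma1_holds]
  -- good reduction off `N ℓ`: Néron–Ogg–Shafarevich
  have hgood : ∀ v : HeightOneSpectrum (𝓞 ℚ), ¬ ((primesEquiv v : ℕ) ∣ N * ℓ) →
      W.HasGoodReductionAt v := by
    intro v hv
    have hpℓ : (primesEquiv v : ℕ) ≠ ℓ := fun h' ↦ hv (by rw [← h']; exact dvd_mul_left _ _)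
    have hℓv : ((ℓ : ℕ) : 𝓞 ℚ) ∉ v.asIdeal := by
      rw [Literature.NumberTheory.GaloisRepresentations.Rat.natCast_mem_asIdeal_iff]
      exact fun h' ↦ hpℓ ((Nat.prime_dvd_prime_iff_eq (primesEquiv v).2 hℓp).mp h')
    exact W.neronOggShafarevich_holds v ℓ hℓv fun 𝔓 h𝔓 τ hτ ↦ (hcl v hv 𝔓 h𝔓).1 τ hτ
  refine ⟨N, hN, f₀, hnew₀, hgood, fun p hp hpNℓ ↦ ?_⟩
  -- the place `v` of `ℚ` at `p`, a prime of `ℤ̄` above it and an arithmetic Frobenius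
  obtain ⟨v, rfl⟩ : ∃ v : HeightOneSpectrum (𝓞 ℚ), (primesEquiv v : ℕ) = p :=
    ⟨primesEquiv.symm ⟨p, hp⟩, by rw [Equiv.apply_symm_apply]⟩
  obtain ⟨𝔓, h𝔓⟩ := primesAbove_nonempty v
  obtain ⟨σ, hσ⟩ := exists_isArithFrobAt_of_mem_primesAbove_holds (v := v) h𝔓
  have hpℓ : (primesEquiv v : ℕ) ≠ ℓ := fun h' ↦ hpNℓ (by rw [← h']; exact dvd_mul_left _ _)
  have hgoodv : W.HasGoodReductionAt v := hgood v hpNℓ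
  have hℓv : ((ℓ : ℕ) : 𝓞 ℚ) ∉ v.asIdeal := by
    rw [Literature.NumberTheory.GaloisRepresentations.Rat.natCast_mem_asIdeal_iff]
    exact fun h' ↦ hpℓ ((Nat.prime_dvd_prime_iff_eq hp hℓp).mp h')
  have htr := W.trace_galoisRepTate_frobenius_of_hasGoodReductionAt_holds ℓ v hℓv hgoodv h𝔓 hσ
  -- compare the `X`-coefficients of the two characteristic polynomials
  have h1 := congrArg (fun P : Polynomial K ↦ P.coeff 1) ((hcl v hpNℓ 𝔓 h𝔓).2 σ hσ)
  rw [Polynomial.coeff_map, Polynomial.coeff_map, coeff_one_X_sq_sub_C_mul_X_add_C',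
    Literature.NumberTheory.EllipticCurves.ModularForms.heckePolynomial,
    coeff_one_X_sq_sub_C_mul_X_add_C', map_neg, map_neg, neg_inj, htr, map_intCast,
    ← map_intCast ι] at h1
  have h2 := congrArg Subtype.val (ι.injective h1)
  change (((W.frobeniusTraceAt v : ℤ) : coeffCharField f) : ℂ) =
    (UpperHalfPlane.qExpansion 1 ⇑f).coeff (primesEquiv v : ℕ) at h2
  rw [cuspCoeff, hcoe, W.lFunction_primesEquiv_eq_frobeniusTraceAt hgoodv, ← h2]
  norm_cast

/-- **The two-prime merge (M0 + M1): no hole.**  If `ρ_{E,ℓ₁}` and `ρ_{E,ℓ₂}` are modular for two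
distinct primes, ONE newform `f₀ ∈ S₂(Γ₀(N))` carries `a_p(E)` for EVERY `p ∤ N`, and `E` is
good off `N`: the hole of each packet at its own prime is covered by the other packet. -/
theorem exists_isNewform0_packet_off_level_of_two_primes (W : WeierstrassCurve ℚ) [W.IsElliptic]
    (ℓ₁ ℓ₂ : ℕ) [Fact ℓ₁.Prime] [Fact ℓ₂.Prime] (hne : ℓ₁ ≠ ℓ₂)
    (h₁ : W.IsModularGaloisRepTate ℓ₁) (h₂ : W.IsModularGaloisRepTate ℓ₂) :
    ∃ (N : ℕ) (_ : NeZero N) (f₀ : CuspForm (Gamma0 N) 2), IsNewform0 f₀ ∧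
      (∀ v : HeightOneSpectrum (𝓞 ℚ), ¬ ((primesEquiv v : ℕ) ∣ N) → W.HasGoodReductionAt v) ∧
      ∀ p : ℕ, p.Prime → ¬ p ∣ N → cuspCoeff f₀ p = (W.LFunction p : ℂ) := by
  have hℓ₁ : ℓ₁.Prime := Fact.out
  have hℓ₂ : ℓ₂.Prime := Fact.out
  obtain ⟨N₁, hN₁, f₁, hf₁, hgood₁, hap₁⟩ :=
    exists_isNewform0_hasGoodReductionAt_of_isModularGaloisRepTate W ℓ₁ h₁
  obtain ⟨N₂, hN₂, f₂, hf₂, hgood₂, hap₂⟩ :=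
    exists_isNewform0_hasGoodReductionAt_of_isModularGaloisRepTate W ℓ₂ h₂
  have hM : N₁ * ℓ₁ * (N₂ * ℓ₂) ≠ 0 :=
    mul_ne_zero (mul_ne_zero (NeZero.ne N₁) hℓ₁.ne_zero) (mul_ne_zero (NeZero.ne N₂) hℓ₂.ne_zero)
  have hagree : ∀ p : ℕ, p.Prime → ¬ p ∣ N₁ * ℓ₁ * (N₂ * ℓ₂) →
      cuspCoeff f₁ p = cuspCoeff f₂ p := by
    intro p hp hpM
    rw [hap₁ p hp fun h ↦ hpM (dvd_mul_of_dvd_left h _),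
      hap₂ p hp fun h ↦ hpM (dvd_mul_of_dvd_right h _)]
  obtain ⟨hN, hcoeff⟩ := level_eq_and_cuspCoeff_eq_of_cuspCoeff_eq_off hf₁ hf₂ hM hagree
  subst hN
  refine ⟨N₁, hN₁, f₁, hf₁, fun v hv ↦ ?_, fun p hp hpN ↦ ?_⟩
  · by_cases hv₁ : (primesEquiv v : ℕ) ∣ N₁ * ℓ₁
    · refine hgood₂ v fun hv₂ ↦ ?_
      have hq : (primesEquiv v : ℕ).Prime := (primesEquiv v).2
      have h1 : (primesEquiv v : ℕ) = ℓ₁ :=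
        (Nat.prime_dvd_prime_iff_eq hq hℓ₁).mp ((hq.dvd_mul.mp hv₁).resolve_left hv)
      have h2 : (primesEquiv v : ℕ) = ℓ₂ :=
        (Nat.prime_dvd_prime_iff_eq hq hℓ₂).mp ((hq.dvd_mul.mp hv₂).resolve_left hv)
      exact hne (h1.symm.trans h2)
    · exact hgood₁ v hv₁
  · by_cases hp₁ : p ∣ N₁ * ℓ₁
    · have h1 : p = ℓ₁ :=
        (Nat.prime_dvd_prime_iff_eq hp hℓ₁).mp ((hp.dvd_mul.mp hp₁).resolve_left hpN)
      have hp₂ : ¬ p ∣ N₁ * ℓ₂ := fun h' ↦ hne (h1.symm.trans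
        ((Nat.prime_dvd_prime_iff_eq hp hℓ₂).mp ((hp.dvd_mul.mp h').resolve_left hpN)))
      rw [hcoeff p]
      exact hap₂ p hp hp₂
    · exact hap₁ p hp hp₁

end TranscribedCS

/-- **R for the compatible system is a THEOREM** (k2 gens 4–6: the packets at `3` and `5` merge). -/
theorem packet_of_isModularGaloisRepTateAll (W : WeierstrassCurve ℚ) [W.IsElliptic]
    (h : IsModularGaloisRepTateAll W) :
    ∃ (N : ℕ) (_ : NeZero N) (f₀ : CuspForm (Gamma0 N) 2), IsNewform0 f₀ ∧
      (∀ v : HeightOneSpectrum (𝓞 ℚ), ¬ ((primesEquiv v : ℕ) ∣ N) → W.HasGoodReductionAt v) ∧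
      ∀ p : ℕ, p.Prime → ¬ p ∣ N → cuspCoeff f₀ p = (W.LFunction p : ℂ) := by
  haveI : Fact (Nat.Prime 3) := ⟨Nat.prime_three⟩
  haveI : Fact (Nat.Prime 5) := ⟨Nat.prime_five⟩
  exact exists_isNewform0_packet_off_level_of_two_primes W 3 5 (by decide) (h 3) (h 5)

/-- **`SigThreeImpTwoCS ↔ FullRigidity`** (⇒ by G7-1 + M1 exactly as for S9; ⇐ by the proved R-for-CS). -/
theorem sigThreeImpTwoCS_iff_fullRigidity : SigThreeImpTwoCS ↔ FullRigidity := by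
  refine ⟨fun h W _ N _ f₀ hf₀ hgood hap ↦ ?_, fun hF W _ _ hall ↦ ?_⟩
  · haveI : NeZero (W.conductorNorm ℤ) := ⟨(conductorNorm_pos_holds W).ne'⟩
    obtain ⟨f, hf⟩ := h W (fun ℓ _ ↦ isModularGaloisRepTate_of_packet W f₀ hf₀ hgood hap ℓ)
    have hM : N * W.conductorNorm ℤ ≠ 0 := mul_ne_zero (NeZero.ne N) (NeZero.ne _)
    have hagree : ∀ p : ℕ, p.Prime → ¬ p ∣ N * W.conductorNorm ℤ →
        cuspCoeff f₀ p = cuspCoeff f p := by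
      intro p hp hpM
      rw [hap p hp fun h' ↦ hpM (dvd_mul_of_dvd_left h' _), hf.2 p]
    obtain ⟨e, hcoeff⟩ := level_eq_and_cuspCoeff_eq_of_cuspCoeff_eq_off hf₀ hf.1 hM hagree
    subst e
    exact ⟨rfl, fun n ↦ by rw [hcoeff n]; exact hf.2 n⟩
  · obtain ⟨N, hN, f₀, hf₀, hgood, hap⟩ := packet_of_isModularGaloisRepTateAll W hall
    obtain ⟨e, hcoeff⟩ := hF W f₀ hf₀ hgood hap
    subst e
    exact ⟨f₀, hf₀, hcoeff⟩

/-- **The CS recut is exactly the level statement plus the sign bit**: `SigThreeImpTwoCS ↔ L ∧ S`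
(unconditional, kernel-checked). -/
theorem sigThreeImpTwoCS_iff : SigThreeImpTwoCS ↔ LevelRigidity ∧ SteinbergSignPacket :=
  sigThreeImpTwoCS_iff_fullRigidity.trans fullRigidity_iff

/-- **S9 = R + (CS recut)**: the verbatim single-prime stub is equivalent to the realisation leaf R
together with the compatible-system stub of k2 gens 3–6. -/
theorem stub_iff_someLevelPacket_and_CS : SigStubThreeImpTwo ↔ SomeLevelPacket ∧ SigThreeImpTwoCS := by
  rw [sigThreeImpTwoCS_iff]
  exact stub_iff_cut

/-! ## §7 Corollary: the registered slot's level hypothesis `hC` is implied by the stub itself -/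

/-- **L ⇒ the tree's named level fact `IsNewformOf.level_eq_conductorNorm` at every level** (the
`IsNewformOf` hypothesis gives the packet: `W` is good off the level because level and conductor
have the same prime divisors, `IsNewformOf.dvd_level_iff_dvd_conductorNorm`, `q`-expansion
arithmetic only). [cite: DiamondShurman2005, Prop. 5.8.5 and (8.44)] -/
theorem level_eq_conductorNorm_of_levelRigidity (hL : LevelRigidity) (N : ℕ) [NeZero N] :
    IsNewformOf.level_eq_conductorNorm (N := N) := by
  intro W _ f hf
  refine hL W f hf.1 (fun v hv ↦ ?_) (fun p _ _ ↦ hf.2 p)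
  by_contra hbad
  exact hv ((hf.dvd_level_iff_dvd_conductorNorm (primesEquiv v).2).mpr
    ((W.dvd_conductorNorm_iff v).mpr hbad))

/-- **S9 ⇒ `∀ N, IsNewformOf.level_eq_conductorNorm (N := N)`**: the hypothesis `hC` of the
registered slot `stub_threeImpTwo_of_two_facts (hES) (hC)` (`Lines/Sketch.lean :584`) is a
CONSEQUENCE of its conclusion — the slot's extra strength over S9 is `hES` alone. -/
theorem level_eq_conductorNorm_of_stub (h : SigStubThreeImpTwo) (N : ℕ) [NeZero N] :
    IsNewformOf.level_eq_conductorNorm (N := N) :=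
  level_eq_conductorNorm_of_levelRigidity (levelRigidity_of_stub h) N

end Summit.ABC.ABC.Cruxes.FreyModularity.Sketch.StubIdeasThreeImpTwo2G7
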